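import Summits.BirchSwinnertonDyer.BirchSwinnertonDyer.Theorems.GenusKolyvaginAtTwoGenusPrimitiveSupplyAtTwoPrimeTwistEggBitFiniteSha
import HarnessLib

/-!
# Route `GenusKolyvaginAtTwo`, crux #2 `GenusPrimitiveSupplyAtTwo` (stmt-BirchSwinnertonDyer-22136):
# the Cassels–Tate RADICAL LINE `⟨g_d⟩` of an odd admissible twist — MEMO-desc §16 (K) «`ker CT_d = κ(W^{(d)}(ℚ)) = ⟨m_d⟩`» —
# and the `-desc` rows in `g`-currency; DESC-P from DESC-A under finiteness of `Ш`

Width seat `bsd-line-gk2-p5` g16 (cell `bsd-f1-sign2`, SUPPLY lineage of crux 22136), file 45 of the series; sequel of files 42–44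
(kernel lemma, B⁰ BY NAME, rank `1` under `θ = −`). THEOREMS ONLY (no definition, no named fact, no `sorry`); helper
`--supports stmt-BirchSwinnertonDyer-22136`; no item is closed; BSD is not proved by any of this.

WHAT.
* §195 `natCard_range_kummerMapTorsion_two_eq_two` (every number field): rank `1` and `#E(K)[2] = 1` ⟹ `#κ₂(E(K)) = #E(K)/2E(K) = 2`
  (`kummerMapTorsion_ker` + the descent count of `E(K)/nE(K)` + Mordell–Weil).
* §196 **`exists_radical_generator_of_model`** — `W` on the odd branch, `d` descent-admissible with character `χ`, ANY model `V = C • W^{(d)}`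
  with `θ(V) = −` and rank `≥ 1`: there is `g ∈ Sel_𝔓(A_χ)`, `g ≠ 0`, with
  `InTwistCasselsTateRadicalAtTwo W χ x ↔ x = 0 ∨ x = g` for every `x` — THE RADICAL OF THE ODD CASSELS–TATE FORM IS THE LINE `⟨g⟩`,
  `g = ψ_* κ(P)` the transported Kummer class of a generator of `V(ℚ)` modulo `2` (radical ⟺ transported Kummer class by the kernel
  lemma of file 42 + exactness; `#κ(V(ℚ)) = #V(ℚ)/2V(ℚ) = 2^{rank}·#V(ℚ)[2] = 2` by file 43 §191's rank `1`).
* §197 `twistRadicalLeaves_iff_not_mem_of_generator` (logic): with such a `g`, `TwistRadicalLeavesAtTwo W χ H ↔ (θ odd ∧ g ∉ H)` — the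
  `-desc` rows DESC-A / A∞ in the memo's `g_d`-currency («the number of `i` with `g_{dᵢ} ∉ H` is even»).
* §198 **`oddBranchEggCasselsTateParityLawAtTwo_of_sumLaw_of_finite`** — DESC-P `F1Sign2.OddBranchEggCasselsTateParityLawAtTwo` (the
  `@[conjecture]` row WITHOUT rank clause) from DESC-A plus finiteness of `Ш(W^{(d)})[2^∞]` for the admissible twists of odd-branch curves
  (file 44 §192 supplies the rank clause of THEOREM B).

Honest framing: Cassels 1962 §1 + Kramer 1981 Prop. 6 + MS21 Thm 1.3 bookkeeping; kernel-new; beyond-print theorem: no. Crux 22136 stays OPEN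
exactly at (U) 24947 ∧ (CONV₂) 19220/24948. BSD is not proved by any of this.

References: [Cassels1962ArithmeticIV] §1; [Kramer1981] Prop. 6; [MorganSmith2021CTP] Thm. 1.3; [MazurRubin2007] §3; [SilvermanAEC2009]
VIII.§2, X.§4.
-/

set_option linter.dupNamespace false -- tree convention: `Summit.BirchSwinnertonDyer.BirchSwinnertonDyer.Theorems` (summit = sub-problem)
set_option autoImplicit false

noncomputable section

open scoped Classical

namespace Summit.BirchSwinnertonDyer.BirchSwinnertonDyer.Theorems.GenusKolyArch

open WeierstrassCurve Field NumberField IsDedekindDomain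
open Literature.NumberTheory.EllipticCurves Literature.NumberTheory.GaloisRepresentations
open Summit.BirchSwinnertonDyer.Rank1Residual.F1Sign2
open Summit.BirchSwinnertonDyer.Rank1Residual.F1Sign2.EggDoubling (eq_zero_of_two_smul_eq_zero)
open Literature.NumberTheory.EllipticCurves.Greenberg1999 (HasRationalTwoTorsionX)

universe u

/-! ## §195 The Kummer image has order `2` at rank one -/

/-- **`#κ₂(E(K)) = 2` for rank one and no rational `2`-torsion** (every number field `K`): the Kummer map `κ₂ : E(K) → H¹(K, E[2])` has
kernel `2E(K)` (`kummerMapTorsion_ker`), so `#κ₂(E(K)) = #E(K)/2E(K) = 2^{rank}·#E(K)[2]` (`natCard_quotient_range_zsmul_eq_pow_mul_card_torsionBy`,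
Mordell–Weil `module_finite_point_holds`) `= 2`. Stated over a general number field so that every instance on `E(K)` is the tree's.
[cite: SilvermanAEC2009, VIII.§2 and Thm X.4.2(a)] -/
theorem natCard_range_kummerMapTorsion_two_eq_two {K : Type u} [Field K] [NumberField K] (V : WeierstrassCurve K) [V.IsElliptic]
    (hdiv : ∀ P : geomPoints V, ∃ Q : geomPoints V, ((2 : ℕ) : ℤ) • Q = P) (hrank : V.mordellWeilRank = 1)
    (htors : Nat.card (AddSubgroup.torsionBy V.toAffine.Point ((2 : ℕ) : ℤ)) = 1) :
    Nat.card (kummerMapTorsion V ((2 : ℕ) : ℤ) hdiv).range = 2 := by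
  haveI : Module.Finite ℤ V.toAffine.Point := V.module_finite_point_holds
  rw [← Nat.card_congr (QuotientAddGroup.quotientKerEquivRange (kummerMapTorsion V ((2 : ℕ) : ℤ) hdiv)).toEquiv,
    kummerMapTorsion_ker, natCard_quotient_range_zsmul_eq_pow_mul_card_torsionBy, htors]
  change 2 ^ V.mordellWeilRank * 1 = 2
  rw [hrank]
  norm_num

/-- **A generator of `κ₂(E(K)) ≅ ℤ/2`** (every number field `K`; rank one, `#E(K)[2] = 1`): some `P₀ ∈ E(K)` has `κ₂(P₀) ≠ 0`, and every
`κ₂(P)` is `0` or `κ₂(P₀)`. Stated over a general number field so that every instance on `E(K)` is the tree's. [cite: SilvermanAEC2009, VIII.§2] -/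
theorem exists_kummerMapTorsion_two_generator {K : Type u} [Field K] [NumberField K] (V : WeierstrassCurve K) [V.IsElliptic]
    (hdiv : ∀ P : geomPoints V, ∃ Q : geomPoints V, ((2 : ℕ) : ℤ) • Q = P) (hrank : V.mordellWeilRank = 1)
    (htors : Nat.card (AddSubgroup.torsionBy V.toAffine.Point ((2 : ℕ) : ℤ)) = 1) :
    ∃ P₀ : V.toAffine.Point, kummerMapTorsion V ((2 : ℕ) : ℤ) hdiv P₀ ≠ 0 ∧
      ∀ P : V.toAffine.Point, kummerMapTorsion V ((2 : ℕ) : ℤ) hdiv P = 0 ∨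
        kummerMapTorsion V ((2 : ℕ) : ℤ) hdiv P = kummerMapTorsion V ((2 : ℕ) : ℤ) hdiv P₀ := by
  set κ := kummerMapTorsion V ((2 : ℕ) : ℤ) hdiv with hκ
  have hrange : Nat.card κ.range = 2 := natCard_range_kummerMapTorsion_two_eq_two V hdiv hrank htors
  obtain ⟨g₀, hg₀, huniq⟩ := (Nat.card_eq_two_iff' (0 : κ.range)).mp hrange
  obtain ⟨P₀, hP₀⟩ : ∃ P₀, κ P₀ = (g₀ : V.galH1Torsion ((2 : ℕ) : ℤ)) := g₀.2
  refine ⟨P₀, fun h ↦ hg₀ (Subtype.ext (hP₀.symm.trans h)), fun P ↦ ?_⟩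
  by_cases h : κ P = 0
  · exact Or.inl h
  · refine Or.inr ?_
    have e : (⟨κ P, P, rfl⟩ : κ.range) = g₀ := huniq _ fun e ↦ h (congrArg Subtype.val e)
    rw [hP₀]
    exact congrArg Subtype.val e

/-! ## §196 The radical of an odd form is the Kummer LINE -/

section Frame

variable (W : WeierstrassCurve ℚ) [W.IsElliptic] [W.IsGloballyMinimal] {d : ℤ}
  {χ : absoluteGaloisGroup ℚ →ₜ* Multiplicative (ZMod 2)}

omit [W.IsElliptic] in
/-- **§196 — THE RADICAL OF AN ODD CASSELS–TATE FORM IS A LINE `⟨g⟩`** (MEMO-desc §16 (K): «`ker CT_d = κ(W^{(d)}(ℚ)) = ⟨m_d⟩`»). For `W`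
on the odd branch, `d` descent-admissible with character `χ`, and ANY model `V = C • W^{(d)}` with `θ(V) = −` and `rank V(ℚ) ≥ 1`: there is a
non-zero `g ∈ Sel_𝔓(A_χ/ℚ)` such that the radical classes of the twist's Cassels–Tate form are exactly `0` and `g` (`g` = the transported
Kummer class `ψ_* κ(P)` of a generator of `V(ℚ)/2V(ℚ) ≅ ℤ/2`). [cite: Cassels1962ArithmeticIV, §1] [cite: Kramer1981, Prop. 6]
[cite: MorganSmith2021CTP, Thm 1.3] [cite: MazurRubin2007, §3, Prop 4.1 and Def 4.3] -/
theorem exists_radical_generator_of_model (hodd : OnOddBranchAtTwo W) (hd : DescAdmissible W d)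
    (hχ : IsQuadraticCharacterOf χ d) {V : WeierstrassCurve ℚ} [V.IsElliptic] {C : VariableChange ℚ}
    (hWd : C • W.quadraticTwist (d : ℚ) = V) (hθ : ¬ ShaTwoInTwiceShaFour V) (hrk : 0 < V.mordellWeilRank) :
    ∃ g ∈ PrimeTwist.selmerGroup W χ, g ≠ 0 ∧ ∀ x, InTwistCasselsTateRadicalAtTwo W χ x ↔ (x = 0 ∨ x = g) := by
  have hd0 : d ≠ 0 := hd.1.ne
  have hd0' : ((d : ℤ) : ℚ) ≠ 0 := Int.cast_ne_zero.mpr hd0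
  -- no rational `2`-torsion on the model `V`
  have hTV : NoRationalTwoTorsion V := by
    intro x hx
    have h' : HasRationalTwoTorsionX (W.quadraticTwist (d : ℚ)) (C⁻¹.toX x) := by
      have h := PrimeConductorTwoTorsion.hasRationalTwoTorsionX_smul V C⁻¹ hx
      rwa [← hWd, inv_smul_smul] at h
    obtain ⟨x', hx'⟩ := (exists_hasRationalTwoTorsionX_quadraticTwist_iff W hd0').mp ⟨_, h'⟩
    exact hodd.2.1 x' hx'
  -- the dictionary and its `H¹` square
  obtain ⟨ψ, hψ, Φ, hΦ, htors, hSel, hSha⟩ := exists_primeTwistModel_selmerGroup_sha_iff W hd0' hWd χ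
    (smul_geomSqrt_iff_of_isQuadraticCharacterOf hχ)
  have hsq := h1Equiv_torsionH1ToH1_eq_twistShaMapAtTwo W ψ hψ Φ hΦ htors
  -- rank `1`, `#Ш(V)[2] = 4`, and the kernel-lemma inputs
  obtain ⟨hr1, hb4, -⟩ := mordellWeilRank_eq_one_of_not_shaTwoInTwiceShaFour_of_model W hodd hd hχ hWd hθ hrk
  have hcard : Nat.card ↥(V.sha ⊓ AddSubgroup.torsionBy V.galH1 ((2 : ℕ) : ℤ)) ≤ 4 := hb4.le
  have hcard0 : Nat.card ↥(V.sha ⊓ AddSubgroup.torsionBy V.galH1 ((2 : ℕ) : ℤ)) ≠ 0 := by rw [hb4]; norm_num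
  set κ := kummerMapTorsion V ((2 : ℕ) : ℤ) (hdiv_two V) with hκ
  -- (a) radical ⟺ transported Kummer class
  have hrad : ∀ x, InTwistCasselsTateRadicalAtTwo W χ x ↔ ∃ P, h1Equiv ψ hψ (κ P) = x := by
    intro x
    constructor
    · rintro ⟨hxR, c', hc'sha, hc'4, hc'2⟩
      set y : V.galH1Torsion ((2 : ℕ) : ℤ) := (h1Equiv ψ hψ).symm x with hy
      have hxy : h1Equiv ψ hψ y = x := (h1Equiv ψ hψ).apply_symm_apply x
      set c'' : V.galH1 := (h1Equiv Φ hΦ).symm c' with hc''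
      have hcc : h1Equiv Φ hΦ c'' = c' := (h1Equiv Φ hΦ).apply_symm_apply c'
      have hc''sha : c'' ∈ V.sha := (hSha _).mpr (hcc.symm ▸ hc'sha)
      have hc''4 : (4 : ℕ) • c'' = 0 := (h1Equiv Φ hΦ).injective (by rw [map_nsmul, hcc, hc'4, map_zero])
      have hc''2 : (2 : ℕ) • c'' = V.torsionH1ToH1 ((2 : ℕ) : ℤ) y :=
        (h1Equiv Φ hΦ).injective (by rw [map_nsmul, hcc, hc'2, hsq, hxy])
      have ht0 : (2 : ℕ) • c'' = 0 :=
        sha_two_nsmul_eq_zero_of_four_nsmul_of_natCard_le_four V hcard hcard0 hθ hc''sha hc''4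
      have hty : V.torsionH1ToH1 ((2 : ℕ) : ℤ) y = 0 := hc''2.symm.trans ht0
      obtain ⟨P, hP⟩ := mem_range_kummerMapTorsion_of_torsionH1ToH1_eq_zero V _ (hdiv_two V) y hty
      exact ⟨P, by rw [← hxy, ← hP]⟩
    · rintro ⟨P, rfl⟩
      refine ⟨(hSel _).mp (kummerMapTorsion_mem_selmerGroup V _ (hdiv_two V) P), _,
        (PrimeTwist.sha W χ).zero_mem, nsmul_zero _, ?_⟩
      rw [nsmul_zero, ← hsq, hκ, torsionH1ToH1_kummerMapTorsion, map_zero]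
  -- (b) `#V(ℚ)[2] = 1` in the tree's currency
  have hinst : (instDecidableEqRat : DecidableEq ℚ) = fun a b => Classical.propDecidable (a = b) := Subsingleton.elim _ _
  have htors1 : Nat.card (AddSubgroup.torsionBy V.toAffine.Point ((2 : ℕ) : ℤ)) = 1 := by
    have hbot : AddSubgroup.torsionBy V.toAffine.Point ((2 : ℕ) : ℤ) = ⊥ :=
      (AddSubgroup.eq_bot_iff_forall _).mpr fun P hP ↦
        eq_zero_of_two_smul_eq_zero V hTV P (AddSubgroup.torsionBy.nsmul_iff.mp hP)
    rw [hbot, AddSubgroup.card_bot]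
  rw [hinst] at htors1
  -- (c) a generator of `κ(V(ℚ)) ≅ ℤ/2` (rank `1`, no `2`-torsion), transported by `ψ`
  obtain ⟨P₀, hP₀, hall⟩ := exists_kummerMapTorsion_two_generator V (hdiv_two V) hr1 htors1
  refine ⟨h1Equiv ψ hψ (κ P₀), (hSel _).mp (kummerMapTorsion_mem_selmerGroup V _ (hdiv_two V) P₀),
    fun h ↦ hP₀ ((h1Equiv ψ hψ).injective (h.trans (map_zero _).symm)), fun x ↦ ?_⟩
  rw [hrad x]
  constructor
  · rintro ⟨P, rfl⟩
    rcases hall P with h | h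
    · exact Or.inl (by rw [h, map_zero])
    · exact Or.inr (by rw [h])
  · rintro (rfl | rfl)
    · exact ⟨0, by rw [map_zero, map_zero]⟩
    · exact ⟨P₀, rfl⟩

end Frame

/-! ## §197 The `-desc` rows in `g`-currency -/

/-- **`TwistRadicalLeavesAtTwo` in `g`-currency.** If the radical classes of the twist's form are exactly `0` and `g` (§196), then for every
subgroup `H`: «the form is odd and its radical leaves `H`» iff «the form is odd and `g ∉ H`». So DESC-A reads «on an admissible square
quadruple, the number of `i` with `g_{dᵢ} ∉ H` is even» and A∞ the same with `H = Sel₂(W)`. [cite: Kramer1981, Prop. 6] -/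
theorem twistRadicalLeaves_iff_not_mem_of_generator (W : WeierstrassCurve ℚ)
    {χ : absoluteGaloisGroup ℚ →ₜ* Multiplicative (ZMod 2)} {g : W.galH1Torsion ((2 : ℕ) : ℤ)}
    (hg : ∀ x, InTwistCasselsTateRadicalAtTwo W χ x ↔ (x = 0 ∨ x = g)) (H : AddSubgroup (W.galH1Torsion ((2 : ℕ) : ℤ))) :
    TwistRadicalLeavesAtTwo W χ H ↔ (TwistCasselsTateOddAtTwo W χ ∧ g ∉ H) := by
  refine and_congr_right fun _ ↦ ⟨?_, fun hgH ↦ ⟨g, (hg g).mpr (Or.inr rfl), hgH⟩⟩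
  rintro ⟨x, hx, hxH⟩
  rcases (hg x).mp hx with rfl | rfl
  · exact absurd H.zero_mem hxH
  · exact hxH

/-! ## §198 DESC-P from DESC-A under finiteness of `Ш` -/

/-- **DESC-P `F1Sign2.OddBranchEggCasselsTateParityLawAtTwo` from DESC-A and finiteness of `Ш(W^{(d)})[2^∞]`** for the descent-admissible
twists of odd-branch curves: THEOREM B ⟸ DESC-A (file 43) with its rank clause supplied by file 44 §192 («finite `Ш[2^∞]` and `θ = −` ⟹
rank `1`»). DESC-A (Morgan 2023 Prop. 19 / Morgan–Smith trilinearity) and the finiteness are NOT proved here.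
[cite: Morgan2023KummerGeneric, §1.2, Prop 19] [cite: Cassels1962ArithmeticIV, §1] [cite: Kramer1981, Prop. 6] -/
theorem oddBranchEggCasselsTateParityLawAtTwo_of_sumLaw_of_finite (hA : OddBranchCasselsTateRadicalSumLawAtTwo)
    (hfin : ∀ (W : WeierstrassCurve ℚ) [W.IsElliptic] [W.IsGloballyMinimal], OnOddBranchAtTwo W →
      ∀ d : ℤ, DescAdmissible W d → Finite (AddCommGroup.primaryComponent (W.quadraticTwist (d : ℚ)).sha 2)) :
    OddBranchEggCasselsTateParityLawAtTwo := by
  intro W _ _ hW d₁ d₂ d₃ d₄ h₁ h₂ h₃ h₄ hsq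
  refine oddBranchEggCasselsTateParityLawOfPosRankAtTwo_of_sumLaw hA W hW d₁ d₂ d₃ d₄ h₁ h₂ h₃ h₄ ?_ hsq
  intro d hd hθ
  have hd' : DescAdmissible W d := by
    simp only [List.mem_cons, List.not_mem_nil, or_false] at hd
    rcases hd with rfl | rfl | rfl | rfl <;> assumption
  haveI := hfin W hW d hd'
  haveI : (W.quadraticTwist (d : ℚ)).IsElliptic := W.isElliptic_quadraticTwist (Int.cast_ne_zero.mpr hd'.1.ne)
  obtain ⟨χ, hχ⟩ := GenusKolyTransp.quadraticCharacterExists_holds d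
  rw [mordellWeilRank_eq_one_of_finite_sha_of_not_shaTwoInTwiceShaFour_of_model W hW hd' hχ (one_smul _ _) hθ]
  exact one_pos

end Summit.BirchSwinnertonDyer.BirchSwinnertonDyer.Theorems.GenusKolyArch

end
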